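import Summits.KontsevichZagierPeriods.KontsevichZagierPeriods.Theorems.UnfoldedStokesStokesGenerationStubIsotopyTransport2
import Summits.KontsevichZagierPeriods.KontsevichZagierPeriods.Theorems.UnfoldedStokesStokesGenerationFibrewiseRungRelations
import Mathlib.Analysis.Calculus.FDeriv.Basic

/-!
# `StokesGeneration` (stmt-KontsevichZagierPeriods-3586), line `fibrewise_stokes` — rung 2″: the rule-(2) relators of isotopies of the square

Crux `Summit.KontsevichZagierPeriods.KontsevichZagierPeriods.Theses.UnfoldedStokes.StokesGeneration` (kernel-checked
equivalent to the summit). Line `fibrewise_stokes` reduces it to the residual S2 = `FibrewiseStokesGenerationConjecture`: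
every bounded closed-cube representation of value `0` is, after padding and off a null `ℚ`-semialgebraic set, a finite
sum of FIBREWISE STOKES ELEMENTS `D − (G|_{xᵢ=1} − G|_{xᵢ=0})` — in particular WITHOUT the change-of-variables move.

Rung 2′ (`…FibrewiseRungTransport.lean`) put the rule-(2) relators of endpoint-fixing reparametrisations of the INTERVAL
in S2's economy. This file does the same in dimension TWO: for `f` of class `C¹` near `[0,1]²` and a `C²` displacement
`V` with `Φ = id + V` mapping the square into itself and preserving each edge (`Vᵢ = 0 = ∂_{other}Vᵢ` on the edges
`xᵢ ∈ {0,1}`; all data `ℚ`-semialgebraic), the relator `f − (f∘Φ)·det DΦ` is the sum of THREE fibrewise Stokes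
elements on `[0,1]³` — the straight-line isotopy `Φᵤ = id + uV` and the two-dimensional Liouville identity
`∂ᵤ[(f∘Φᵤ)·det DΦᵤ] = div((f∘Φᵤ)·adj(DΦᵤ)·V)`, whose fluxes through the edges vanish
(`stub_isotopyTransport2`). Baker-free. Kernel form: `of_mem_relations_isotopy2`. Together with rung 6
(`…FibrewiseRungDlogSwap.lean`: a linear NON-isotopic map, the transposition, on the dlog layer) this documents how far
S2's economy absorbs Kontsevich–Zagier's rule (2) without ever changing variables.

References: M. Kontsevich, D. Zagier, *Periods* (2001), §1.2 rule (2); J. Ayoub, Ann. of Math. 181 (2015), Rem. 1.5.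
-/

noncomputable section

set_option linter.dupNamespace false

namespace Summit.KontsevichZagierPeriods.KontsevichZagierPeriods.Cruxes.StokesGeneration.FibrewiseStokes

open MeasureTheory Set
open Literature.NumberTheory.Transcendental
open Literature.NumberTheory.Transcendental.KZ
open Literature.ModelTheory.ExponentialFields (IsSemialgebraic)

/-- **S2 for the change-of-variables relators of face-preserving isotopies of the square (rung 2″, assembled; lead c4).**
For `f` of class `C¹` near `[0,1]²` and a `C²` displacement `V` with `Φ = id + V` mapping the square into itself and
preserving each edge (all data `ℚ`-semialgebraic), the closed-square representation with integrand the rule-(2) relator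
`f − (f∘Φ)·det DΦ` satisfies the conclusion of `FibrewiseStokesGeneration` with `M′ = 3`: THREE fibrewise Stokes elements
on `[0,1]³` from the straight-line isotopy `Φᵤ = id + uV` and the two-dimensional Liouville identity
`∂ᵤ[(f∘Φᵤ) det DΦᵤ] = div((f∘Φᵤ)·adj(DΦᵤ)V)` (`stub_isotopyTransport2`); Baker-free. [cite: KontsevichZagier2001, §1.2 rule (2)] -/
theorem fibrewiseStokesGeneration_isotopy2 :
    ∀ (U : Set (Fin 2 → ℝ)) (f : (Fin 2 → ℝ) → ℝ) (f' : (Fin 2 → ℝ) → (Fin 2 → ℝ) →L[ℝ] ℝ)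
      (V : Fin 2 → (Fin 2 → ℝ) → ℝ) (W : Fin 2 → Fin 2 → (Fin 2 → ℝ) → ℝ) (M : Fin 2 → (Fin 2 → ℝ) → ℝ),
      IsOpen U → Set.pi Set.univ (fun _ : Fin 2 => Set.Icc (0:ℝ) 1) ⊆ U →
      IsSemialgebraicFunOn ℚ (Set.pi Set.univ (fun _ : Fin 2 => Set.Icc (0:ℝ) 1)) f →
      (∀ i, IsSemialgebraicFunOn ℚ (Set.pi Set.univ (fun _ : Fin 2 => Set.Icc (0:ℝ) 1)) (fun p => f' p (Pi.single i 1))) →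
      ContinuousOn f (Set.pi Set.univ (fun _ : Fin 2 => Set.Icc (0:ℝ) 1)) →
      (∀ i, ContinuousOn (fun p => f' p (Pi.single i 1)) (Set.pi Set.univ (fun _ : Fin 2 => Set.Icc (0:ℝ) 1))) →
      (∀ p ∈ U, HasFDerivAt f (f' p) p) →
      (∀ i, IsSemialgebraicFunOn ℚ (Set.pi Set.univ (fun _ : Fin 2 => Set.Icc (0:ℝ) 1)) (V i)) →
      (∀ i j, IsSemialgebraicFunOn ℚ (Set.pi Set.univ (fun _ : Fin 2 => Set.Icc (0:ℝ) 1)) (W i j)) →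
      (∀ i, IsSemialgebraicFunOn ℚ (Set.pi Set.univ (fun _ : Fin 2 => Set.Icc (0:ℝ) 1)) (M i)) →
      (∀ i, ContinuousOn (V i) (Set.pi Set.univ (fun _ : Fin 2 => Set.Icc (0:ℝ) 1))) →
      (∀ i j, ContinuousOn (W i j) (Set.pi Set.univ (fun _ : Fin 2 => Set.Icc (0:ℝ) 1))) →
      (∀ i, ContinuousOn (M i) (Set.pi Set.univ (fun _ : Fin 2 => Set.Icc (0:ℝ) 1))) →
      (∀ i j, ∀ x ∈ Set.pi Set.univ (fun _ : Fin 2 => Set.Icc (0:ℝ) 1), x j ∈ Set.Ioo (0:ℝ) 1 →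
        HasDerivAt (fun s : ℝ => V i (Function.update x j s)) (W i j x) (x j)) →
      (∀ i, ∀ x ∈ Set.pi Set.univ (fun _ : Fin 2 => Set.Icc (0:ℝ) 1), x 0 ∈ Set.Ioo (0:ℝ) 1 →
        HasDerivAt (fun s : ℝ => W i 1 (Function.update x 0 s)) (M i x) (x 0)) →
      (∀ i, ∀ x ∈ Set.pi Set.univ (fun _ : Fin 2 => Set.Icc (0:ℝ) 1), x 1 ∈ Set.Ioo (0:ℝ) 1 →
        HasDerivAt (fun s : ℝ => W i 0 (Function.update x 1 s)) (M i x) (x 1)) →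
      (∀ x ∈ Set.pi Set.univ (fun _ : Fin 2 => Set.Icc (0:ℝ) 1), ∀ i, x i + V i x ∈ Set.Icc (0:ℝ) 1) →
      (∀ x ∈ Set.pi Set.univ (fun _ : Fin 2 => Set.Icc (0:ℝ) 1), ∀ i, (x i = 0 ∨ x i = 1) →
        V i x = 0 ∧ W i (Fin.rev i) x = 0) →
      ∀ (t : IntegralRep 2), t.domain = Set.pi Set.univ (fun _ : Fin 2 => Set.Icc (0:ℝ) 1) →
      (∀ z ∈ Set.pi Set.univ (fun _ : Fin 2 => Set.Icc (0:ℝ) 1), t.integrand z =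
        f ![z 0, z 1] - f ![z 0 + V 0 ![z 0, z 1], z 1 + V 1 ![z 0, z 1]] *
          ((1 + W 0 0 ![z 0, z 1]) * (1 + W 1 1 ![z 0, z 1]) - W 0 1 ![z 0, z 1] * W 1 0 ![z 0, z 1])) →
    ∃ (M' : ℕ) (hMM' : 2 ≤ M') (J : ℕ) (i : Fin J → Fin M') (G D : Fin J → (Fin M' → ℝ) → ℝ)
      (K : Fin J → Set (Fin M' → ℝ)) (q : Fin J → IntegralRep M') (Z : Set (Fin M' → ℝ)),
      (∀ j, IsSemialgebraicFunOn ℚ (Set.pi Set.univ (fun _ : Fin M' => Set.Icc (0:ℝ) 1)) (G j) ∧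
        IsSemialgebraicFunOn ℚ (Set.pi Set.univ (fun _ : Fin M' => Set.Icc (0:ℝ) 1)) (D j) ∧
        IsSemialgebraic ℚ (K j) ∧
        (∃ B : ℝ, ∀ x ∈ Set.pi Set.univ (fun _ : Fin M' => Set.Icc (0:ℝ) 1), |(G j) x| ≤ B) ∧
        (∀ x ∈ Set.pi Set.univ (fun _ : Fin M' => Set.Icc (0:ℝ) 1), Set.Finite {s : ℝ | Function.update x (i j) s ∈ (K j)}) ∧
        (∀ x ∈ Set.pi Set.univ (fun _ : Fin M' => Set.Icc (0:ℝ) 1), ContinuousOn (fun s : ℝ => (G j) (Function.update x (i j) s)) (Set.Icc (0:ℝ) 1)) ∧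
        (∀ x ∈ Set.pi Set.univ (fun _ : Fin M' => Set.Icc (0:ℝ) 1), x ∉ (K j) → x (i j) ∈ Set.Ioo (0:ℝ) 1 →
          HasDerivAt (fun s : ℝ => (G j) (Function.update x (i j) s)) ((D j) x) (x (i j)))) ∧
      (∀ j, (q j).domain = Set.pi Set.univ (fun _ : Fin M' => Set.Icc (0:ℝ) 1) ∧
        ∀ x ∈ Set.pi Set.univ (fun _ : Fin M' => Set.Icc (0:ℝ) 1), (q j).integrand x =
          D j x - (G j (Function.update x (i j) 1) - G j (Function.update x (i j) 0))) ∧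
      IsSemialgebraic ℚ Z ∧ volume Z = 0 ∧
      ∀ x ∈ Set.pi Set.univ (fun _ : Fin M' => Set.Icc (0:ℝ) 1), x ∉ Z →
        t.integrand (fun l => x (Fin.castLE hMM' l)) = ∑ j, (q j).integrand x := by
  intro U f f' V W M hU hSU hf hf' hfc hf'c hfd hV hW hM hVc hWc hMc hVd hM0 hM1 hinto hface t _ hti
  obtain ⟨G, D, r, hGD, hr, hid⟩ := stub_isotopyTransport2 U f f' V W M hU hSU hf hf' hfc hf'c hfd hV hW hM hVc
    hWc hMc hVd hM0 hM1 hinto hface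
  refine ⟨3, by norm_num, 3, fun j => Fin.rev j, G, D, fun _ => ∅, r, ∅, fun j => ?_, hr,
    Literature.ModelTheory.ExponentialFields.isSemialgebraic_empty, measure_empty, ?_⟩
  · obtain ⟨h1, h2, h3, h4, h5⟩ := hGD j
    exact ⟨h1, h2, Literature.ModelTheory.ExponentialFields.isSemialgebraic_empty, h3,
      fun x _ => by simp, h4, fun x hx _ hxj => h5 x hx hxj⟩
  · intro x hx _
    have hx2 : (fun l : Fin 2 => x (Fin.castLE (by norm_num : 2 ≤ 3) l)) ∈
        Set.pi Set.univ (fun _ : Fin 2 => Set.Icc (0:ℝ) 1) := fun l _ => hx _ (Set.mem_univ _)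
    rw [hti _ hx2]
    exact hid x hx

/-- **The crux on the isotopy sector of the square (kernel form, dimension two).** The closed-square representation with
integrand the rule-(2) relator `f − (f∘Φ)·det DΦ` of a face-preserving `C²` isotopy end `Φ = id + V` (data as in
`fibrewiseStokesGeneration_isotopy2`) is a Kontsevich–Zagier relation (∘ the landed bridge
`of_mem_relations_of_fibStokesDecomposition`). [cite: KontsevichZagier2001, §1.2 Conjecture 1] -/
theorem of_mem_relations_isotopy2 (U : Set (Fin 2 → ℝ)) (f : (Fin 2 → ℝ) → ℝ) (f' : (Fin 2 → ℝ) → (Fin 2 → ℝ) →L[ℝ] ℝ)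
    (V : Fin 2 → (Fin 2 → ℝ) → ℝ) (W : Fin 2 → Fin 2 → (Fin 2 → ℝ) → ℝ) (M : Fin 2 → (Fin 2 → ℝ) → ℝ)
    (hU : IsOpen U) (hSU : Set.pi Set.univ (fun _ : Fin 2 => Set.Icc (0:ℝ) 1) ⊆ U)
    (hf : IsSemialgebraicFunOn ℚ (Set.pi Set.univ (fun _ : Fin 2 => Set.Icc (0:ℝ) 1)) f)
    (hf' : ∀ i, IsSemialgebraicFunOn ℚ (Set.pi Set.univ (fun _ : Fin 2 => Set.Icc (0:ℝ) 1)) (fun p => f' p (Pi.single i 1)))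
    (hfc : ContinuousOn f (Set.pi Set.univ (fun _ : Fin 2 => Set.Icc (0:ℝ) 1)))
    (hf'c : ∀ i, ContinuousOn (fun p => f' p (Pi.single i 1)) (Set.pi Set.univ (fun _ : Fin 2 => Set.Icc (0:ℝ) 1)))
    (hfd : ∀ p ∈ U, HasFDerivAt f (f' p) p)
    (hV : ∀ i, IsSemialgebraicFunOn ℚ (Set.pi Set.univ (fun _ : Fin 2 => Set.Icc (0:ℝ) 1)) (V i))
    (hW : ∀ i j, IsSemialgebraicFunOn ℚ (Set.pi Set.univ (fun _ : Fin 2 => Set.Icc (0:ℝ) 1)) (W i j))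
    (hM : ∀ i, IsSemialgebraicFunOn ℚ (Set.pi Set.univ (fun _ : Fin 2 => Set.Icc (0:ℝ) 1)) (M i))
    (hVc : ∀ i, ContinuousOn (V i) (Set.pi Set.univ (fun _ : Fin 2 => Set.Icc (0:ℝ) 1)))
    (hWc : ∀ i j, ContinuousOn (W i j) (Set.pi Set.univ (fun _ : Fin 2 => Set.Icc (0:ℝ) 1)))
    (hMc : ∀ i, ContinuousOn (M i) (Set.pi Set.univ (fun _ : Fin 2 => Set.Icc (0:ℝ) 1)))
    (hVd : ∀ i j, ∀ x ∈ Set.pi Set.univ (fun _ : Fin 2 => Set.Icc (0:ℝ) 1), x j ∈ Set.Ioo (0:ℝ) 1 →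
      HasDerivAt (fun s : ℝ => V i (Function.update x j s)) (W i j x) (x j))
    (hM0 : ∀ i, ∀ x ∈ Set.pi Set.univ (fun _ : Fin 2 => Set.Icc (0:ℝ) 1), x 0 ∈ Set.Ioo (0:ℝ) 1 →
      HasDerivAt (fun s : ℝ => W i 1 (Function.update x 0 s)) (M i x) (x 0))
    (hM1 : ∀ i, ∀ x ∈ Set.pi Set.univ (fun _ : Fin 2 => Set.Icc (0:ℝ) 1), x 1 ∈ Set.Ioo (0:ℝ) 1 →
      HasDerivAt (fun s : ℝ => W i 0 (Function.update x 1 s)) (M i x) (x 1))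
    (hinto : ∀ x ∈ Set.pi Set.univ (fun _ : Fin 2 => Set.Icc (0:ℝ) 1), ∀ i, x i + V i x ∈ Set.Icc (0:ℝ) 1)
    (hface : ∀ x ∈ Set.pi Set.univ (fun _ : Fin 2 => Set.Icc (0:ℝ) 1), ∀ i, (x i = 0 ∨ x i = 1) →
      V i x = 0 ∧ W i (Fin.rev i) x = 0)
    (t : IntegralRep 2) (ht : t.domain = Set.pi Set.univ (fun _ : Fin 2 => Set.Icc (0:ℝ) 1))
    (hti : ∀ z ∈ Set.pi Set.univ (fun _ : Fin 2 => Set.Icc (0:ℝ) 1), t.integrand z =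
      f ![z 0, z 1] - f ![z 0 + V 0 ![z 0, z 1], z 1 + V 1 ![z 0, z 1]] *
        ((1 + W 0 0 ![z 0, z 1]) * (1 + W 1 1 ![z 0, z 1]) - W 0 1 ![z 0, z 1] * W 1 0 ![z 0, z 1])) :
    of t ∈ relations :=
  of_mem_relations_of_fibStokesDecomposition 2 t ht
    (fibrewiseStokesGeneration_isotopy2 U f f' V W M hU hSU hf hf' hfc hf'c hfd hV hW hM hVc hWc hMc hVd hM0 hM1
      hinto hface t ht hti)

end Summit.KontsevichZagierPeriods.KontsevichZagierPeriods.Cruxes.StokesGeneration.FibrewiseStokes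

end
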